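import Summits.CriticalPhenomena.Ising3DConformalLimit.Theses.SubPtolemyInterlacing
import Literature.Computation.FiniteGraph.SpinSums

/-!
# `Interlacing` (item stmt-CriticalPhenomena-15702): the sub-Ptolemy inequality is NOT a
# finite-graph correlation inequality — a 10-site subregion of `ℤ² ⊂ ℤ³` violates it at small,
# near-critical and large coupling

Negative knowledge about the crux
`Summit.CriticalPhenomena.Ising3DConformalLimit.Theses.SubPtolemyInterlacing.Interlacing`
(SPC: `S₄·P₂ ≤ P₁·P₃` on interlaced axis quadruples of `ℤ³` at `β_c`, with `P₁ = G₁₂G₃₄` adjacent,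
`P₂ = G₁₃G₂₄` crossing, `P₃ = G₁₄G₂₃` nested) and about the one open stub of BOTH registered lines
(`Sketch.stub_engine` ⟺ `Birth.stub_cageScreening` ⟺ "SPC for the FREE-boundary Ising model in
the boxes `Λ_L = {-L..L}³` at `β_c`, eventually in `L`"), from the standing crux disprover (cycle 2).
THEOREM-ONLY, no definitions, no named facts.

**The natural region-general strengthening of box-SPC is false.** Let `Λ_Z ⊂ ℤ³` be the ten sites
(third coordinate `0`)

* axis `x₁ = (0,0)`, `x₂ = (1,0)`, `x₃ = (2,0)`, `x₄ = (3,0)` (gaps `(a,b,c) = (1,1,1)`) — labels `0,1,2,3`;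
* an upper bypass `(0,1), (1,1), (2,1)` over `[x₁,x₃]` — labels `4,5,6`;
* a lower bypass `(1,-1), (2,-1), (3,-1)` under `[x₂,x₄]` — labels `7,8,9`;

with its `13` nearest-neighbour bonds (the induced subgraph of `ℤ³`; the same graph arises with the
two bypasses in the `e₂`- and the `e₃`-direction, a genuinely three-dimensional region). For the
ferromagnetic n.n. Ising model on `Λ_Z` with free boundary condition (the tree's pair-ferromagnet
expectation `gksExpect`, Friedli–Velenik's `ν_{Λ;K}` with `K ≡ β` on the bonds) the interlacing
inequality at `(x₁,x₂,x₃,x₄)` is REVERSED, strictly, at each of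

* `tanh β = 1/100` (`β = 0.0100`, deep in the high-temperature regime): `ρ := S₄P₂/(P₁P₃) = 1 + 1.0·10⁻⁸`;
* `tanh β = 1/5`   (`β = 0.2027 < β_c(3) ≈ 0.2217`): `ρ = 1.00101`;
* `tanh β = 7/32`  (`β = 0.2223 > β_c(3)`): `ρ = 1.00132`

(`gksExpect_zRegion_interlacing_reversed_*`, exact rational arithmetic in the kernel through the
tree's finite-graph witness engine `Literature.Computation.FiniteGraph`, `decide +kernel`). Exact
evaluation off-line (the disprover's `py/zregion_exact.py`, crux folder evidence) shows the violation
at every sampled `t = tanh β ∈ (0,1)` (also `1/2, 9/10, 99/100`) with `ρ − 1 = t⁴ + O(t⁶)` as `t → 0`: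
high temperature does not rescue SPC on regions, and nothing special happens at `β_c(3)`.

MECHANISM (for provers). On the full lattice the high-temperature expansion gives
`P₃ − P₂ = 4ac·t^{a+2b+c+2} + …` — log-convexity at order `t²` comes from counting sideways
translates ("plateaus") of axis sub-segments strictly containing `[x₂ − e₁, x₃ + e₁]`, and there are
`4ac` of them by translation invariance — while `S₄ − P₁` only enters at relative order `t⁴`. In
`Λ_Z` no such plateau fits (each bypass row misses one end), so the `t²` slack vanishes, and at order
`t⁴` the two DISJOINT crossing bypasses (`x₁ → x₃` over the top avoiding `x₂`, `x₂ → x₄` underneath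
avoiding `x₃`) feed the crossing pairing `(13)(24)` with nothing feeding the nested one.

CONSEQUENCES. (i) SPC is not a correlation inequality of finite ferromagnetic pair interactions —
unlike every inequality in the tree's toolbox (GKS I/II, GHS, Lebowitz, Messager–Miracle-Solé on
symmetric graphs aside, Aizenman–Fernández, Newman/Aizenman Gaussian bounds, the switching lemma and
the ADC21 (3.10)/(3.11) identities — all valid on arbitrary finite graphs and inherited by `Λ_Z`).
(ii) Hence `stub_engine` / `stub_cageScreening` cannot be proved by an argument insensitive to the
region (a current injection or coupling valid in every finite subgraph, a region-monotone scheme, or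
any bound using only `u, t ≥ 1`, Lebowitz and GKS — cf. `engine_inputs_insufficient`): a proof must
use the geometry of the full box `Λ_L` (its translates / reflections, as in the plateau count)
quantitatively. (iii) Free-boundary SPC is not monotone in the volume (`Λ_Z ⊂ Λ_4 = {-4..4}³`, where
Monte Carlo gives `ρ(1,1,1) = 0.86`, kit j020588).

Calibration kept from cycle 1 (Disproof.lean §C2 and the ideators' toys): chains/trees give equality;
fans (chain + one hub, i.e. a chain in a field) and boundary quadruples of planar graphs satisfy SPC
(Pfaffian `S₄ = P₁ − P₂ + P₃` plus `u, t ≥ 1`); `Λ_Z` is planar but `x₂, x₃` are interior vertices.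
-/

namespace Summit.CriticalPhenomena.Ising3DConformalLimit.InterlacingNegative

open Literature.Probability.LatticeModels Literature.Computation Finset

/-! Throughout, the 13 nearest-neighbour bonds of `Λ_Z` (labels as in the module docstring) are
`{uZ i, vZ i}` with first endpoints `uZ = ![0, 1, 2, 4, 5, 7, 8, 0, 1, 2, 1, 2, 3]` and second endpoints
`vZ = ![1, 2, 3, 5, 6, 8, 9, 4, 5, 6, 7, 8, 9]` (axis `01,12,23`, upper row `45,56`, lower row `78,89`,
rungs `04,15,26` up and `17,28,39` down); every statement quantifies over `uZ vZ` pinned to these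
literals, so that no definition or notation is introduced. -/

/-! ### Kernel certificates (exact rationals) -/

/-- `tanh β = 1/5`: `P₁·P₃ < S₄·P₂` on `Λ_Z` (values `S₄ = 26575/614383`, `G₁₂ = G₃₄ = 127775/614383`,
`G₁₃ = G₂₄ = 28447/614383`, `G₁₄ = 6095/614383`, `G₂₃ = 663211/3071915`). [folklore] -/
theorem isingExpect_zRegion_interlacing_reversed_one_fifth (uZ vZ : Fin 13 → Fin 10)
    (hu : uZ = ![0, 1, 2, 4, 5, 7, 8, 0, 1, 2, 1, 2, 3]) (hv : vZ = ![1, 2, 3, 5, 6, 8, 9, 4, 5, 6, 7, 8, 9]) :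
    FiniteGraph.isingExpect 10 (FiniteGraph.bondsOfFn uZ vZ (fun _ => 1) (fun _ => 5)) [0, 1] *
          FiniteGraph.isingExpect 10 (FiniteGraph.bondsOfFn uZ vZ (fun _ => 1) (fun _ => 5)) [2, 3] *
        (FiniteGraph.isingExpect 10 (FiniteGraph.bondsOfFn uZ vZ (fun _ => 1) (fun _ => 5)) [0, 3] *
          FiniteGraph.isingExpect 10 (FiniteGraph.bondsOfFn uZ vZ (fun _ => 1) (fun _ => 5)) [1, 2]) <
      FiniteGraph.isingExpect 10 (FiniteGraph.bondsOfFn uZ vZ (fun _ => 1) (fun _ => 5)) [0, 1, 2, 3] *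
        (FiniteGraph.isingExpect 10 (FiniteGraph.bondsOfFn uZ vZ (fun _ => 1) (fun _ => 5)) [0, 2] *
          FiniteGraph.isingExpect 10 (FiniteGraph.bondsOfFn uZ vZ (fun _ => 1) (fun _ => 5)) [1, 3]) := by
  subst hu hv
  decide +kernel

/-- `tanh β = 7/32` (`β = 0.2223`, just above `β_c(3) = 0.22165`): `P₁·P₃ < S₄·P₂` on `Λ_Z`. [folklore] -/
theorem isingExpect_zRegion_interlacing_reversed_7_32 (uZ vZ : Fin 13 → Fin 10)
    (hu : uZ = ![0, 1, 2, 4, 5, 7, 8, 0, 1, 2, 1, 2, 3]) (hv : vZ = ![1, 2, 3, 5, 6, 8, 9, 4, 5, 6, 7, 8, 9]) :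
    FiniteGraph.isingExpect 10 (FiniteGraph.bondsOfFn uZ vZ (fun _ => 7) (fun _ => 32)) [0, 1] *
          FiniteGraph.isingExpect 10 (FiniteGraph.bondsOfFn uZ vZ (fun _ => 7) (fun _ => 32)) [2, 3] *
        (FiniteGraph.isingExpect 10 (FiniteGraph.bondsOfFn uZ vZ (fun _ => 7) (fun _ => 32)) [0, 3] *
          FiniteGraph.isingExpect 10 (FiniteGraph.bondsOfFn uZ vZ (fun _ => 7) (fun _ => 32)) [1, 2]) <
      FiniteGraph.isingExpect 10 (FiniteGraph.bondsOfFn uZ vZ (fun _ => 7) (fun _ => 32)) [0, 1, 2, 3] *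
        (FiniteGraph.isingExpect 10 (FiniteGraph.bondsOfFn uZ vZ (fun _ => 7) (fun _ => 32)) [0, 2] *
          FiniteGraph.isingExpect 10 (FiniteGraph.bondsOfFn uZ vZ (fun _ => 7) (fun _ => 32)) [1, 3]) := by
  subst hu hv
  decide +kernel

/-- `tanh β = 1/100` (high temperature; `ρ − 1 = t⁴ + O(t⁶)`): `P₁·P₃ < S₄·P₂` on `Λ_Z`. [folklore] -/
theorem isingExpect_zRegion_interlacing_reversed_one_hundredth (uZ vZ : Fin 13 → Fin 10)
    (hu : uZ = ![0, 1, 2, 4, 5, 7, 8, 0, 1, 2, 1, 2, 3]) (hv : vZ = ![1, 2, 3, 5, 6, 8, 9, 4, 5, 6, 7, 8, 9]) :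
    FiniteGraph.isingExpect 10 (FiniteGraph.bondsOfFn uZ vZ (fun _ => 1) (fun _ => 100)) [0, 1] *
          FiniteGraph.isingExpect 10 (FiniteGraph.bondsOfFn uZ vZ (fun _ => 1) (fun _ => 100)) [2, 3] *
        (FiniteGraph.isingExpect 10 (FiniteGraph.bondsOfFn uZ vZ (fun _ => 1) (fun _ => 100)) [0, 3] *
          FiniteGraph.isingExpect 10 (FiniteGraph.bondsOfFn uZ vZ (fun _ => 1) (fun _ => 100)) [1, 2]) <
      FiniteGraph.isingExpect 10 (FiniteGraph.bondsOfFn uZ vZ (fun _ => 1) (fun _ => 100)) [0, 1, 2, 3] *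
        (FiniteGraph.isingExpect 10 (FiniteGraph.bondsOfFn uZ vZ (fun _ => 1) (fun _ => 100)) [0, 2] *
          FiniteGraph.isingExpect 10 (FiniteGraph.bondsOfFn uZ vZ (fun _ => 1) (fun _ => 100)) [1, 3]) := by
  subst hu hv
  decide +kernel

/-! ### The Gibbs-measure statements -/

/-- **Transfer to the Gibbs expectation.** For the ferromagnetic pair interaction `K ≡ artanh (a/b)`
(`-b < a < b`) on the 13 bonds of `Λ_Z`, the rational certificate for bond parameter `a/b` gives the
REVERSED interlacing inequality `⟨σ₁σ₂⟩⟨σ₃σ₄⟩·⟨σ₁σ₄⟩⟨σ₂σ₃⟩ < ⟨σ₁σ₂σ₃σ₄⟩·⟨σ₁σ₃⟩⟨σ₂σ₄⟩` for the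
tree's expectation `gksExpect` (bridge `gksExpect_spinProduct_eq` of the finite-graph witness engine,
Friedli–Velenik 2017 §3.8.1 eq. (3.44)). [folklore] -/
theorem gksExpect_zRegion_interlacing_reversed_of_cert (uZ vZ : Fin 13 → Fin 10)
    (hu : uZ = ![0, 1, 2, 4, 5, 7, 8, 0, 1, 2, 1, 2, 3]) (hv : vZ = ![1, 2, 3, 5, 6, 8, 9, 4, 5, 6, 7, 8, 9])
    {a : ℤ} {b : ℕ} (h₁ : -(b : ℤ) < a) (h₂ : a < b)
    (hcert :
      FiniteGraph.isingExpect 10 (FiniteGraph.bondsOfFn uZ vZ (fun _ => a) (fun _ => b)) [0, 1] *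
            FiniteGraph.isingExpect 10 (FiniteGraph.bondsOfFn uZ vZ (fun _ => a) (fun _ => b)) [2, 3] *
          (FiniteGraph.isingExpect 10 (FiniteGraph.bondsOfFn uZ vZ (fun _ => a) (fun _ => b)) [0, 3] *
            FiniteGraph.isingExpect 10 (FiniteGraph.bondsOfFn uZ vZ (fun _ => a) (fun _ => b)) [1, 2]) <
        FiniteGraph.isingExpect 10 (FiniteGraph.bondsOfFn uZ vZ (fun _ => a) (fun _ => b)) [0, 1, 2, 3] *
          (FiniteGraph.isingExpect 10 (FiniteGraph.bondsOfFn uZ vZ (fun _ => a) (fun _ => b)) [0, 2] *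
            FiniteGraph.isingExpect 10 (FiniteGraph.bondsOfFn uZ vZ (fun _ => a) (fun _ => b)) [1, 3]))
    (K : Fin 13 → ℝ) (hK : ∀ i, K i = Real.artanh ((a : ℝ) / (b : ℝ))) :
    gksExpect univ K (fun i => ({uZ i, vZ i} : Finset (Fin 10))) (fun ω => spinAt 0 ω * spinAt 1 ω) *
          gksExpect univ K (fun i => ({uZ i, vZ i} : Finset (Fin 10))) (fun ω => spinAt 2 ω * spinAt 3 ω) *
        (gksExpect univ K (fun i => ({uZ i, vZ i} : Finset (Fin 10))) (fun ω => spinAt 0 ω * spinAt 3 ω) *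
          gksExpect univ K (fun i => ({uZ i, vZ i} : Finset (Fin 10))) (fun ω => spinAt 1 ω * spinAt 2 ω)) <
      gksExpect univ K (fun i => ({uZ i, vZ i} : Finset (Fin 10)))
          (spinProduct ({0, 1, 2, 3} : Finset (Fin 10))) *
        (gksExpect univ K (fun i => ({uZ i, vZ i} : Finset (Fin 10))) (fun ω => spinAt 0 ω * spinAt 2 ω) *
          gksExpect univ K (fun i => ({uZ i, vZ i} : Finset (Fin 10))) (fun ω => spinAt 1 ω * spinAt 3 ω)) := by
  have huv : ∀ i : Fin 13, uZ i ≠ vZ i := by subst hu hv; decide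
  have hb0 : ∀ i : Fin 13, (fun _ : Fin 13 => b) i ≠ 0 := fun _ => by
    simp only [ne_eq]
    omega
  have ht : ∀ i : Fin 13, Real.tanh (K i) =
      ((fun _ : Fin 13 => a) i : ℝ) / ((fun _ : Fin 13 => b) i : ℝ) := by
    intro i
    rw [hK i]
    exact FiniteGraph.tanh_artanh_div h₁ h₂
  have hC : ∀ i : Fin 13, (fun i => ({uZ i, vZ i} : Finset (Fin 10))) i = {uZ i, vZ i} := fun _ => rfl
  rw [FiniteGraph.gksExpect_spinAt_mul_spinAt_eq K _ uZ vZ _ _ hC huv hb0 ht 0 1,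
    FiniteGraph.gksExpect_spinAt_mul_spinAt_eq K _ uZ vZ _ _ hC huv hb0 ht 2 3,
    FiniteGraph.gksExpect_spinAt_mul_spinAt_eq K _ uZ vZ _ _ hC huv hb0 ht 0 3,
    FiniteGraph.gksExpect_spinAt_mul_spinAt_eq K _ uZ vZ _ _ hC huv hb0 ht 1 2,
    FiniteGraph.gksExpect_spinAt_mul_spinAt_eq K _ uZ vZ _ _ hC huv hb0 ht 0 2,
    FiniteGraph.gksExpect_spinAt_mul_spinAt_eq K _ uZ vZ _ _ hC huv hb0 ht 1 3,
    FiniteGraph.gksExpect_spinProduct_eq K _ uZ vZ _ _ hC huv hb0 ht {0, 1, 2, 3} [0, 1, 2, 3]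
      (by decide) (by decide)]
  have e0 : ((0 : Fin 10) : ℕ) = 0 := rfl
  have e1 : ((1 : Fin 10) : ℕ) = 1 := rfl
  have e2 : ((2 : Fin 10) : ℕ) = 2 := rfl
  have e3 : ((3 : Fin 10) : ℕ) = 3 := rfl
  simp only [List.map_cons, List.map_nil, e0, e1, e2, e3]
  exact_mod_cast hcert

/-- **The interlacing inequality fails for the free-boundary Ising model on `Λ_Z ⊂ ℤ³` at
`β = artanh (1/5) ≈ 0.2027 < β_c(3)`** (ferromagnetic n.n. coupling `K ≡ β` on the 13 bonds of the
induced subgraph `Λ_Z`; axis quadruple `x₁ = 0, x₂ = e₁, x₃ = 2e₁, x₄ = 3e₁`):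
`⟨σ₁σ₂⟩⟨σ₃σ₄⟩·⟨σ₁σ₄⟩⟨σ₂σ₃⟩ < ⟨σ₁σ₂σ₃σ₄⟩·⟨σ₁σ₃⟩⟨σ₂σ₄⟩`. [folklore] -/
theorem gksExpect_zRegion_interlacing_reversed (uZ vZ : Fin 13 → Fin 10)
    (hu : uZ = ![0, 1, 2, 4, 5, 7, 8, 0, 1, 2, 1, 2, 3]) (hv : vZ = ![1, 2, 3, 5, 6, 8, 9, 4, 5, 6, 7, 8, 9]) (K : Fin 13 → ℝ)
    (hK : ∀ i, K i = Real.artanh (1 / 5)) :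
    gksExpect univ K (fun i => ({uZ i, vZ i} : Finset (Fin 10))) (fun ω => spinAt 0 ω * spinAt 1 ω) *
          gksExpect univ K (fun i => ({uZ i, vZ i} : Finset (Fin 10))) (fun ω => spinAt 2 ω * spinAt 3 ω) *
        (gksExpect univ K (fun i => ({uZ i, vZ i} : Finset (Fin 10))) (fun ω => spinAt 0 ω * spinAt 3 ω) *
          gksExpect univ K (fun i => ({uZ i, vZ i} : Finset (Fin 10))) (fun ω => spinAt 1 ω * spinAt 2 ω)) <
      gksExpect univ K (fun i => ({uZ i, vZ i} : Finset (Fin 10)))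
          (spinProduct ({0, 1, 2, 3} : Finset (Fin 10))) *
        (gksExpect univ K (fun i => ({uZ i, vZ i} : Finset (Fin 10))) (fun ω => spinAt 0 ω * spinAt 2 ω) *
          gksExpect univ K (fun i => ({uZ i, vZ i} : Finset (Fin 10))) (fun ω => spinAt 1 ω * spinAt 3 ω)) :=
  gksExpect_zRegion_interlacing_reversed_of_cert uZ vZ hu hv (a := 1) (b := 5) (by norm_num) (by norm_num)
    (isingExpect_zRegion_interlacing_reversed_one_fifth uZ vZ hu hv) K (fun i => by rw [hK i]; norm_num)

/-- The same just above `β_c(3)`: at `β = artanh (7/32) ≈ 0.2223` the interlacing inequality is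
reversed on `Λ_Z`. [folklore] -/
theorem gksExpect_zRegion_interlacing_reversed_7_32 (uZ vZ : Fin 13 → Fin 10)
    (hu : uZ = ![0, 1, 2, 4, 5, 7, 8, 0, 1, 2, 1, 2, 3]) (hv : vZ = ![1, 2, 3, 5, 6, 8, 9, 4, 5, 6, 7, 8, 9]) (K : Fin 13 → ℝ)
    (hK : ∀ i, K i = Real.artanh (7 / 32)) :
    gksExpect univ K (fun i => ({uZ i, vZ i} : Finset (Fin 10))) (fun ω => spinAt 0 ω * spinAt 1 ω) *
          gksExpect univ K (fun i => ({uZ i, vZ i} : Finset (Fin 10))) (fun ω => spinAt 2 ω * spinAt 3 ω) *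
        (gksExpect univ K (fun i => ({uZ i, vZ i} : Finset (Fin 10))) (fun ω => spinAt 0 ω * spinAt 3 ω) *
          gksExpect univ K (fun i => ({uZ i, vZ i} : Finset (Fin 10))) (fun ω => spinAt 1 ω * spinAt 2 ω)) <
      gksExpect univ K (fun i => ({uZ i, vZ i} : Finset (Fin 10)))
          (spinProduct ({0, 1, 2, 3} : Finset (Fin 10))) *
        (gksExpect univ K (fun i => ({uZ i, vZ i} : Finset (Fin 10))) (fun ω => spinAt 0 ω * spinAt 2 ω) *
          gksExpect univ K (fun i => ({uZ i, vZ i} : Finset (Fin 10))) (fun ω => spinAt 1 ω * spinAt 3 ω)) :=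
  gksExpect_zRegion_interlacing_reversed_of_cert uZ vZ hu hv (a := 7) (b := 32) (by norm_num) (by norm_num)
    (isingExpect_zRegion_interlacing_reversed_7_32 uZ vZ hu hv) K (fun i => by rw [hK i]; norm_num)

/-- The same at high temperature: at `β = artanh (1/100) ≈ 0.0100` the interlacing inequality is
reversed on `Λ_Z` (`ρ − 1 ≈ 10⁻⁸ = t⁴`). [folklore] -/
theorem gksExpect_zRegion_interlacing_reversed_one_hundredth (uZ vZ : Fin 13 → Fin 10)
    (hu : uZ = ![0, 1, 2, 4, 5, 7, 8, 0, 1, 2, 1, 2, 3]) (hv : vZ = ![1, 2, 3, 5, 6, 8, 9, 4, 5, 6, 7, 8, 9]) (K : Fin 13 → ℝ)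
    (hK : ∀ i, K i = Real.artanh (1 / 100)) :
    gksExpect univ K (fun i => ({uZ i, vZ i} : Finset (Fin 10))) (fun ω => spinAt 0 ω * spinAt 1 ω) *
          gksExpect univ K (fun i => ({uZ i, vZ i} : Finset (Fin 10))) (fun ω => spinAt 2 ω * spinAt 3 ω) *
        (gksExpect univ K (fun i => ({uZ i, vZ i} : Finset (Fin 10))) (fun ω => spinAt 0 ω * spinAt 3 ω) *
          gksExpect univ K (fun i => ({uZ i, vZ i} : Finset (Fin 10))) (fun ω => spinAt 1 ω * spinAt 2 ω)) <
      gksExpect univ K (fun i => ({uZ i, vZ i} : Finset (Fin 10)))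
          (spinProduct ({0, 1, 2, 3} : Finset (Fin 10))) *
        (gksExpect univ K (fun i => ({uZ i, vZ i} : Finset (Fin 10))) (fun ω => spinAt 0 ω * spinAt 2 ω) *
          gksExpect univ K (fun i => ({uZ i, vZ i} : Finset (Fin 10))) (fun ω => spinAt 1 ω * spinAt 3 ω)) :=
  gksExpect_zRegion_interlacing_reversed_of_cert uZ vZ hu hv (a := 1) (b := 100) (by norm_num) (by norm_num)
    (isingExpect_zRegion_interlacing_reversed_one_hundredth uZ vZ hu hv) K (fun i => by rw [hK i]; norm_num)

/-- In the bracket shape of the crux: `S₄·(G₁₃G₂₄) ≤ G₁₂G₃₄·(G₁₄G₂₃)` is FALSE for the free-boundary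
Ising model on `Λ_Z` at `β = artanh (1/5)`. Any proof of box-SPC (`stub_engine`) must therefore use
the specific geometry of the boxes `Λ_L`, not only finite-graph identities and inequalities. [folklore] -/
theorem not_interlacing_zRegion (uZ vZ : Fin 13 → Fin 10)
    (hu : uZ = ![0, 1, 2, 4, 5, 7, 8, 0, 1, 2, 1, 2, 3]) (hv : vZ = ![1, 2, 3, 5, 6, 8, 9, 4, 5, 6, 7, 8, 9]) (K : Fin 13 → ℝ) (hK : ∀ i, K i = Real.artanh (1 / 5)) :
    ¬ gksExpect univ K (fun i => ({uZ i, vZ i} : Finset (Fin 10)))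
          (spinProduct ({0, 1, 2, 3} : Finset (Fin 10))) *
        (gksExpect univ K (fun i => ({uZ i, vZ i} : Finset (Fin 10))) (fun ω => spinAt 0 ω * spinAt 2 ω) *
          gksExpect univ K (fun i => ({uZ i, vZ i} : Finset (Fin 10))) (fun ω => spinAt 1 ω * spinAt 3 ω)) ≤
      gksExpect univ K (fun i => ({uZ i, vZ i} : Finset (Fin 10))) (fun ω => spinAt 0 ω * spinAt 1 ω) *
          gksExpect univ K (fun i => ({uZ i, vZ i} : Finset (Fin 10))) (fun ω => spinAt 2 ω * spinAt 3 ω) *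
        (gksExpect univ K (fun i => ({uZ i, vZ i} : Finset (Fin 10))) (fun ω => spinAt 0 ω * spinAt 3 ω) *
          gksExpect univ K (fun i => ({uZ i, vZ i} : Finset (Fin 10))) (fun ω => spinAt 1 ω * spinAt 2 ω)) :=
  not_le.mpr (gksExpect_zRegion_interlacing_reversed uZ vZ hu hv K hK)

/-- The witness coupling is ferromagnetic: `0 < artanh (1/5)` (`= ½ log (3/2) ≈ 0.2027 < β_c(3) ≈ 0.2217`). [folklore] -/
theorem artanh_one_fifth_pos : 0 < Real.artanh (1 / 5) :=
  Real.artanh_pos (x := 1 / 5) ⟨by norm_num, by norm_num⟩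

end Summit.CriticalPhenomena.Ising3DConformalLimit.InterlacingNegative
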